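import Summits.QuantumFields.YangMills.Theorems.F4SubCurvatureDoorHexagonNormalFormDefs
import Literature.Analysis.Complex.Hurwitz
import Mathlib
import HarnessLib

/-!
# Hexagon normal form — (O2) `G` is real-rooted (Hurwitz), repaired and proved

Support lemma toward the OPEN finite-type hexagon conjecture behind crux `stmt-QuantumFields-23125`
(`F4SubCurvatureDoor.RationalToGeneral`; owner ym-idea-3's optional free-hands menu item (m3), statements in
`F4SubCurvatureDoorHexagonNormalFormDefs.lean`).

* (the menu statement `RealRootedO2` is false AS TYPED in the degenerate case `G ≡ 0` — `not_realRootedO2`, landed by seat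
  sfw-p2-w4 in `F4SubCurvatureDoorHexagonRealRootedO2Degenerate.lean`, p674380);
* `realRootedO2_or_zero` — the REPAIRED statement, PROVED: for real entire `F, G` with `WickHexagon F G`, either `G ≡ 0` or every zero
  of `G` is real.  Proof (the card's): `Φ_s = F + P_s G` has only real zeros for `s ≥ 0`, and `Φ_s/(−32 s³) → G` locally uniformly
  as `s → ∞` (`P_s(w) = w³ − 18 s w² + 48 s² w − 32 s³`); Hurwitz's theorem (tree: `Complex.hurwitz_eqOn_zero_or_forall_ne_zero`)
  on the upper half-plane gives `G|ℍ ≡ 0` (hence `G ≡ 0` by the identity theorem) or `G` zero-free on `ℍ`; the lower half-plane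
  follows by the reality of `G`;
* `realRootedO2'` — the owner's repaired form VERBATIM (HOME l15/HexagonSketch.lean `RealRootedO2'`, hypothesis `∃ z, G z ≠ 0`).

Mathlib + `Literature.Analysis.Complex.Hurwitz` only; THEOREMS ONLY; no `sorry`; default heartbeats.  Nothing about crux 23125, crux
23035, any LADDER-YM rung or the Yang–Mills mass gap is proved here.  Free-hands seat `ym-line-frs-p2` g10,
`--supports stmt-QuantumFields-23125`.
-/

set_option autoImplicit false

open ComplexConjugate Filter Topology

namespace Summit.QuantumFields.YangMills.Cruxes.RationalToGeneral.HexagonNormalForm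

/-- The cubic multiplier expanded: `P_s(w) = w³ − 18 s w² + 48 s² w − 32 s³`. -/
theorem P_expand (s : ℝ) (w : ℂ) :
    P s w = w ^ 3 - 18 * (s : ℂ) * w ^ 2 + 48 * (s : ℂ) ^ 2 * w - 32 * (s : ℂ) ^ 3 := by
  unfold P; ring

/-- **(O2), repaired: `G` is real-rooted or identically zero** (Hurwitz as `s → ∞`). [folklore] -/
theorem realRootedO2_or_zero :
    ∀ F G : ℂ → ℂ, IsRealEntire F → IsRealEntire G → WickHexagon F G →
      (∀ z, G z = 0) ∨ ∀ z : ℂ, G z = 0 → z.im = 0 := by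
  intro F G hF hG hW
  classical
  -- the upper half-plane
  obtain ⟨U, hU⟩ : ∃ U : Set ℂ, U = {z : ℂ | 0 < z.im} := ⟨_, rfl⟩
  have hUo : IsOpen U := by rw [hU]; exact isOpen_lt continuous_const Complex.continuous_im
  have hUc : IsPreconnected U := by rw [hU]; exact (convex_halfSpace_im_gt 0).isPreconnected
  -- the rescaled family `Φ_n = (F + P_{n+1} G) / (−32 (n+1)³)`
  obtain ⟨Φ, hΦ⟩ : ∃ Φ : ℕ → ℂ → ℂ,
      Φ = fun (n : ℕ) (z : ℂ) => (F z + P ((n : ℝ) + 1) z * G z) / (-(32 * (((n : ℝ) + 1 : ℝ) : ℂ) ^ 3)) := ⟨_, rfl⟩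
  have hden : ∀ n : ℕ, (-(32 * (((n : ℝ) + 1 : ℝ) : ℂ) ^ 3)) ≠ 0 := by
    intro n
    have h1 : (((n : ℝ) + 1 : ℝ) : ℂ) ≠ 0 := Complex.ofReal_ne_zero.2 (by positivity)
    exact neg_ne_zero.2 (mul_ne_zero (by norm_num) (pow_ne_zero 3 h1))
  have hdiffΦ : ∀ n, DifferentiableOn ℂ (Φ n) U := by
    intro n
    rw [hΦ]
    have hP : Differentiable ℂ (fun z => P ((n : ℝ) + 1) z) := by unfold P; fun_prop
    exact ((hF.1.add (hP.mul hG.1)).div_const _).differentiableOn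
  have hΦne : ∀ n, ∀ z ∈ U, Φ n z ≠ 0 := by
    intro n z hz h0
    rw [hΦ] at h0
    rcases div_eq_zero_iff.1 h0 with h1 | h1
    · have h2 := (hW ((n : ℝ) + 1) (by positivity) z h1).1
      rw [hU, Set.mem_setOf_eq] at hz
      exact absurd h2 (ne_of_gt hz)
    · exact hden n h1
  -- locally uniform convergence `Φ_n → G` on `U`
  have hlim : TendstoLocallyUniformlyOn Φ G atTop U := by
    rw [tendstoLocallyUniformlyOn_iff_forall_isCompact hUo]
    intro K _ hK
    -- one continuous majorant on `K`
    have hwc : ContinuousOn (fun z : ℂ => ‖F z‖ + ‖z ^ 3 * G z‖ + 18 * ‖z ^ 2 * G z‖ + 48 * ‖z * G z‖) K := by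
      have hFc := hF.1.continuous
      have hGc := hG.1.continuous
      fun_prop
    obtain ⟨M, hM⟩ := hK.exists_bound_of_continuousOn hwc
    have hM' : ∀ z ∈ K, ‖F z‖ + ‖z ^ 3 * G z‖ + 18 * ‖z ^ 2 * G z‖ + 48 * ‖z * G z‖ ≤ max M 0 := by
      intro z hz
      exact ((le_abs_self _).trans ((Real.norm_eq_abs _).symm.le.trans (hM z hz))).trans (le_max_left _ _)
    have hbound : ∀ (n : ℕ) (z : ℂ), z ∈ K → ‖Φ n z - G z‖ ≤ max M 0 / ((n : ℝ) + 1) := by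
      intro n z hz
      obtain ⟨s, hs⟩ : ∃ s : ℝ, s = (n : ℝ) + 1 := ⟨_, rfl⟩
      have hs1 : 1 ≤ s := by rw [hs]; linarith [(Nat.cast_nonneg n : (0 : ℝ) ≤ n)]
      have hs0 : 0 < s := by linarith
      have hsC : (s : ℂ) ≠ 0 := Complex.ofReal_ne_zero.2 hs0.ne'
      have hid : Φ n z - G z =
          (F z + z ^ 3 * G z - 18 * (s : ℂ) * (z ^ 2 * G z) + 48 * (s : ℂ) ^ 2 * (z * G z)) / (-(32 * (s : ℂ) ^ 3)) := by
        rw [hΦ]; simp only []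
        rw [← hs, P_expand]
        field_simp
        ring
      rw [hid, norm_div, norm_neg, norm_mul, norm_pow, Complex.norm_real, Real.norm_eq_abs, abs_of_pos hs0,
        ← hs]
      have h32 : ‖(32 : ℂ)‖ = 32 := by simp
      rw [h32, div_le_div_iff₀ (by positivity) hs0]
      -- numerator estimate
      have hnum : ‖F z + z ^ 3 * G z - 18 * (s : ℂ) * (z ^ 2 * G z) + 48 * (s : ℂ) ^ 2 * (z * G z)‖ ≤
          ‖F z‖ + ‖z ^ 3 * G z‖ + 18 * s * ‖z ^ 2 * G z‖ + 48 * s ^ 2 * ‖z * G z‖ := by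
        have e1 : ‖18 * (s : ℂ) * (z ^ 2 * G z)‖ = 18 * s * ‖z ^ 2 * G z‖ := by
          rw [norm_mul, norm_mul, Complex.norm_real, Real.norm_eq_abs, abs_of_pos hs0]; simp
        have e2 : ‖48 * (s : ℂ) ^ 2 * (z * G z)‖ = 48 * s ^ 2 * ‖z * G z‖ := by
          rw [norm_mul, norm_mul, norm_pow, Complex.norm_real, Real.norm_eq_abs, abs_of_pos hs0]; simp
        calc ‖F z + z ^ 3 * G z - 18 * (s : ℂ) * (z ^ 2 * G z) + 48 * (s : ℂ) ^ 2 * (z * G z)‖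
            ≤ ‖F z + z ^ 3 * G z - 18 * (s : ℂ) * (z ^ 2 * G z)‖ + ‖48 * (s : ℂ) ^ 2 * (z * G z)‖ := norm_add_le _ _
          _ ≤ (‖F z + z ^ 3 * G z‖ + ‖18 * (s : ℂ) * (z ^ 2 * G z)‖) + ‖48 * (s : ℂ) ^ 2 * (z * G z)‖ := by
              gcongr; exact norm_sub_le _ _
          _ ≤ ((‖F z‖ + ‖z ^ 3 * G z‖) + ‖18 * (s : ℂ) * (z ^ 2 * G z)‖) + ‖48 * (s : ℂ) ^ 2 * (z * G z)‖ := by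
              gcongr; exact norm_add_le _ _
          _ = ‖F z‖ + ‖z ^ 3 * G z‖ + 18 * s * ‖z ^ 2 * G z‖ + 48 * s ^ 2 * ‖z * G z‖ := by rw [e1, e2]
      have hA := norm_nonneg (F z)
      have hB := norm_nonneg (z ^ 3 * G z)
      have hC := norm_nonneg (z ^ 2 * G z)
      have hD := norm_nonneg (z * G z)
      have hw := hM' z hz
      have hs2 : s ≤ s ^ 2 := by nlinarith
      have hs3 : (1 : ℝ) ≤ s ^ 2 := by nlinarith
      calc ‖F z + z ^ 3 * G z - 18 * (s : ℂ) * (z ^ 2 * G z) + 48 * (s : ℂ) ^ 2 * (z * G z)‖ * s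
          ≤ (‖F z‖ + ‖z ^ 3 * G z‖ + 18 * s * ‖z ^ 2 * G z‖ + 48 * s ^ 2 * ‖z * G z‖) * s :=
            mul_le_mul_of_nonneg_right hnum hs0.le
        _ ≤ (s ^ 2 * (‖F z‖ + ‖z ^ 3 * G z‖ + 18 * ‖z ^ 2 * G z‖ + 48 * ‖z * G z‖)) * s := by
            apply mul_le_mul_of_nonneg_right _ hs0.le
            nlinarith [mul_nonneg hC (sub_nonneg.2 hs2), mul_nonneg hA (sub_nonneg.2 hs3), mul_nonneg hB (sub_nonneg.2 hs3)]
        _ ≤ (s ^ 2 * max M 0) * s := by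
            apply mul_le_mul_of_nonneg_right _ hs0.le
            exact mul_le_mul_of_nonneg_left hw (by positivity)
        _ = max M 0 * (32 * s ^ 3) / 32 := by ring
        _ ≤ max M 0 * (32 * s ^ 3) := by
            apply div_le_self _ (by norm_num)
            positivity
    rw [Metric.tendstoUniformlyOn_iff]
    intro ε hε
    obtain ⟨N, hN⟩ := exists_nat_gt (max M 0 / ε)
    refine Filter.eventually_atTop.2 ⟨N, fun n hn z hz => ?_⟩
    rw [dist_comm, dist_eq_norm]
    refine (hbound n z hz).trans_lt ?_
    have hn1 : (0 : ℝ) < (n : ℝ) + 1 := by positivity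
    rw [div_lt_iff₀ hn1]
    have h1 : max M 0 / ε < (n : ℝ) + 1 := hN.trans_le (by exact_mod_cast Nat.le_succ_of_le hn)
    rw [div_lt_iff₀ hε] at h1
    linarith
  -- Hurwitz on the upper half-plane
  have hH := Complex.hurwitz_eqOn_zero_or_forall_ne_zero (l := atTop) hUo hUc (Filter.Eventually.of_forall hdiffΦ) hlim
    (Filter.Frequently.of_forall hΦne)
  rcases hH with hzero | hne
  · -- `G` vanishes on `ℍ`, hence everywhere
    left
    have han : AnalyticOnNhd ℂ G Set.univ := (hG.1.differentiableOn).analyticOnNhd isOpen_univ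
    have hI : Complex.I ∈ U := by rw [hU, Set.mem_setOf_eq, Complex.I_im]; exact one_pos
    have hev : G =ᶠ[𝓝 Complex.I] 0 := hzero.eventuallyEq_of_mem (hUo.mem_nhds hI)
    have hall := han.eqOn_zero_of_preconnected_of_eventuallyEq_zero isPreconnected_univ (Set.mem_univ _) hev
    exact fun z => hall (Set.mem_univ z)
  · right
    intro z hz
    rcases lt_trichotomy z.im 0 with hlt | heq | hgt
    · -- lower half-plane: use the reality of `G`
      exfalso
      have h1 : G (conj z) = 0 := by rw [hG.2 z, hz, map_zero]
      have h2 : conj z ∈ U := by rw [hU, Set.mem_setOf_eq, Complex.conj_im]; linarith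
      exact hne _ h2 h1
    · exact heq
    · exfalso
      exact hne z (by rw [hU, Set.mem_setOf_eq]; exact hgt) hz

/-- **(O2) in the owner's repaired form** (`RealRootedO2'` of HOME l15/HexagonSketch.lean, body verbatim): a real entire `G ≢ 0` with the
hexagon Wick condition is real-rooted. [folklore] -/
theorem realRootedO2' :
    ∀ F G : ℂ → ℂ, IsRealEntire F → IsRealEntire G → (∃ z : ℂ, G z ≠ 0) → WickHexagon F G → ∀ z : ℂ, G z = 0 → z.im = 0 := by
  intro F G hF hG hne hW z hz
  rcases realRootedO2_or_zero F G hF hG hW with h0 | h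
  · obtain ⟨w, hw⟩ := hne
    exact absurd (h0 w) hw
  · exact h z hz

end Summit.QuantumFields.YangMills.Cruxes.RationalToGeneral.HexagonNormalForm
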